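import Mathlib.Topology.ContinuousMap.SecondCountableSpace
import Mathlib.Topology.ContinuousMap.Compact
import Mathlib.Analysis.Calculus.IteratedDeriv.Lemmas
import Literature.NumberTheory.LFunctions.WeilExplicit
import HarnessLib

/-!
# A countable family of window tests dense in every `C^k` sup-seminorm (`stub_denseFamily`)

Stub `stub_denseFamily` of the line `defect-compactness-design` for the crux `WindowTraceArch`
(stmt-RiemannHypothesis-11195; skeleton
`Summit.RiemannHypothesis.RiemannHypothesis.Cruxes.WindowTraceArch.DefectCompactnessDesign`).

**Statement.** There is a sequence `g j` (`j ∈ ℕ`) of Weil tests (`IsWeilTest`: smooth of compact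
support) supported in the closed window `K = [-log 2, log 2]` such that for every Weil test `f`
supported in `K`, every `k : ℕ` and every `ε > 0` some `g j` satisfies
`‖(f - g j)^{(i)}(t)‖ ≤ ε` for all `i ≤ k` and all `t : ℝ`. In other words the space `𝒟_K` of test
functions supported in the compact set `K` is separable for the family of `C^k` sup-seminorms. This
is the pure real-analysis input of the line (no number theory); the neighbour
`stub_extensionOfDense` consumes it verbatim.

**Proof.** We prove the statement for an arbitrary compact `K ⊆ ℝ`
(`stub_denseFamily_of_isCompact`) by an abstract separability argument, instead of the classical
explicit family (cutoffs times polynomials with rational coefficients). Consider the jet map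
`Φ : 𝒟_K → (ℕ → C(K, ℂ))`, `Φ f i := f^{(i)}|_K`. The target is second countable: `C(K, ℂ)` with
its compact-open (= sup-metric, `K` compact) topology is second countable because `K` is second
countable and locally compact and `ℂ` is second countable
(`ContinuousMap.instSecondCountableTopology`), and a countable product of second-countable spaces
is second countable. Hence the range of `Φ` is a separable subspace and contains a dense SEQUENCE
`Φ (G n)` (`TopologicalSpace.exists_dense_seq`); put `g := G`. Given `f ∈ 𝒟_K`, `k` and `ε > 0`,
the box `{m | ∀ i ≤ k, dist (m i) (Φ f i) < ε}` is open in the product topology and contains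
`Φ f`, so it contains some `Φ (G n)`; then `‖f^{(i)}(t) - (G n)^{(i)}(t)‖ < ε` for `t ∈ K`
(`ContinuousMap.dist_apply_le_dist`), while for `t ∉ K` both derivatives vanish because all
derivatives of a function are supported in its topological support
(`support_iteratedFDeriv_subset`). Finally `(f - G n)^{(i)} = f^{(i)} - (G n)^{(i)}`
(`iteratedDeriv_sub`).

**Sources.** Separability of `𝒟_K` (indeed of `C^k(K)` and of `𝒟_K` as a Fréchet space) is
standard: L. Schwartz, *Théorie des distributions* (1966), Ch. III §1; F. Trèves, *Topological
Vector Spaces, Distributions and Kernels* (1967), Ch. 14–15; W. Rudin, *Functional Analysis*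
(1991), §1.46 and §6.2. All ingredients are Mathlib facts. [folklore]
-/

set_option linter.dupNamespace false

noncomputable section

open Set TopologicalSpace
open scoped Topology ContDiff

namespace Summit.RiemannHypothesis.RiemannHypothesis.Theorems.SpectralTraceWindowTraceArch

open Literature.NumberTheory.LFunctions

/-- All derivatives of a function vanish outside its topological support: if `tsupport f ⊆ K`
and `t ∉ K` then `f^{(i)}(t) = 0` (`support_iteratedFDeriv_subset`). [folklore] -/
theorem stub_denseFamily_iteratedDeriv_eq_zero {f : ℝ → ℂ} {K : Set ℝ} (hf : tsupport f ⊆ K)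
    (i : ℕ) {t : ℝ} (ht : t ∉ K) : iteratedDeriv i f t = 0 := by
  have h : iteratedFDeriv ℝ i f t = 0 := by
    by_contra hne
    exact ht (hf (support_iteratedFDeriv_subset i (Function.mem_support.2 hne)))
  simp [iteratedDeriv_eq_iteratedFDeriv, h]

/-- **Separability of `𝒟_K` in every `C^k` sup-seminorm, for an arbitrary compact `K ⊆ ℝ`.**
There is a sequence `g j` of Weil tests supported in `K` such that every Weil test `f` supported in
`K` is, for every `k` and `ε > 0`, `ε`-close to some `g j` together with all derivatives of order
`≤ k`, uniformly on `ℝ`. Proof: the jet map `f ↦ (f^{(i)}|_K)_i` lands in the second-countable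
space `ℕ → C(K, ℂ)`, so its range contains a dense sequence; outside `K` all derivatives vanish.
[folklore] -/
theorem stub_denseFamily_of_isCompact {K : Set ℝ} (hK : IsCompact K) :
    ∃ g : ℕ → ℝ → ℂ,
      (∀ j, IsWeilTest (g j) ∧ tsupport (g j) ⊆ K) ∧
      ∀ f : ℝ → ℂ, IsWeilTest f → tsupport f ⊆ K →
        ∀ (k : ℕ) (ε : ℝ), 0 < ε → ∃ j, ∀ i ≤ k, ∀ t : ℝ, ‖iteratedDeriv i (f - g j) t‖ ≤ ε := by
  haveI : CompactSpace K := isCompact_iff_compactSpace.mp hK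
  -- smoothness of Weil tests at every finite order
  have hcd : ∀ {f : ℝ → ℂ}, IsWeilTest f → ∀ i : ℕ, ContDiff ℝ i f := fun hf i =>
    contDiff_infty.1 hf.1 i
  -- the jet map into the second-countable space `ℕ → C(K, ℂ)`
  let S := {f : ℝ → ℂ // IsWeilTest f ∧ tsupport f ⊆ K}
  have hcont : ∀ (f : S) (i : ℕ), Continuous fun x : K => iteratedDeriv i f.1 x := fun f i =>
    (ContDiff.continuous_iteratedDeriv' i (hcd f.2.1 i)).comp continuous_subtype_val
  let Φ : S → ℕ → C(K, ℂ) := fun f i => ⟨fun x : K => iteratedDeriv i f.1 x, hcont f i⟩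
  -- zero is a window test, so the range of `Φ` is nonempty
  have h0 : IsWeilTest (0 : ℝ → ℂ) ∧ tsupport (0 : ℝ → ℂ) ⊆ K :=
    ⟨⟨contDiff_const, HasCompactSupport.zero⟩, by simp⟩
  haveI : Nonempty (Set.range Φ) := ⟨⟨Φ ⟨0, h0⟩, ⟨0, h0⟩, rfl⟩⟩
  -- a dense sequence in the (separable, since second-countable) range of `Φ`
  obtain ⟨u, hu⟩ := TopologicalSpace.exists_dense_seq (Set.range Φ)
  choose G hG using fun n => (u n).2
  refine ⟨fun n => (G n).1, fun n => (G n).2, ?_⟩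
  intro f hf hfK k ε hε
  -- the open box of jets `ε`-close to the jet of `f` up to order `k`
  let O : Set (ℕ → C(K, ℂ)) :=
    Set.pi (↑(Finset.range (k + 1))) fun i => Metric.ball (Φ ⟨f, hf, hfK⟩ i) ε
  have hO : IsOpen O :=
    isOpen_set_pi (Finset.finite_toSet _) fun i _ => Metric.isOpen_ball
  have hmem : Φ ⟨f, hf, hfK⟩ ∈ O := fun i _ => Metric.mem_ball_self hε
  obtain ⟨n, hn⟩ := hu.exists_mem_open (hO.preimage continuous_subtype_val)
    ⟨⟨Φ ⟨f, hf, hfK⟩, ⟨f, hf, hfK⟩, rfl⟩, hmem⟩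
  refine ⟨n, fun i hi t => ?_⟩
  have hni : dist (Φ (G n) i) (Φ ⟨f, hf, hfK⟩ i) < ε := by
    have h1 : (u n).1 ∈ O := hn
    rw [← hG n] at h1
    exact Metric.mem_ball.1 (h1 i (by simp [Nat.lt_succ_of_le hi]))
  rw [iteratedDeriv_sub (hcd hf i).contDiffAt (hcd (G n).2.1 i).contDiffAt]
  by_cases ht : t ∈ K
  · calc ‖iteratedDeriv i f t - iteratedDeriv i (G n).1 t‖
          = dist (Φ ⟨f, hf, hfK⟩ i ⟨t, ht⟩) (Φ (G n) i ⟨t, ht⟩) := (dist_eq_norm _ _).symm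
      _ ≤ dist (Φ ⟨f, hf, hfK⟩ i) (Φ (G n) i) := ContinuousMap.dist_apply_le_dist _
      _ ≤ ε := by rw [dist_comm]; exact hni.le
  · rw [stub_denseFamily_iteratedDeriv_eq_zero hfK i ht,
      stub_denseFamily_iteratedDeriv_eq_zero (G n).2.2 i ht, sub_zero, norm_zero]
    exact hε.le

/-- **stub_denseFamily — a countable family of window tests dense in every `C^k` sup-seminorm.**
There is a sequence `g j` of Weil tests supported in the closed window `K = [-log 2, log 2]` such
that for every Weil test `f` supported in `K`, every `k` and every `ε > 0` some `g j` has
`‖(f - g j)^{(i)}(t)‖ ≤ ε` for all `i ≤ k` and all `t` (separability of `𝒟_K`; Schwartz 1966,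
Ch. III §1; Trèves 1967, Ch. 14–15). Proof: `stub_denseFamily_of_isCompact` with `K` the compact
interval `[-log 2, log 2]`. [folklore] -/
theorem stub_denseFamily :
    ∃ g : ℕ → ℝ → ℂ,
      (∀ j, Literature.NumberTheory.LFunctions.IsWeilTest (g j) ∧ tsupport (g j) ⊆ Set.Icc (-Real.log 2) (Real.log 2)) ∧
      ∀ f : ℝ → ℂ, Literature.NumberTheory.LFunctions.IsWeilTest f → tsupport f ⊆ Set.Icc (-Real.log 2) (Real.log 2) →
        ∀ (k : ℕ) (ε : ℝ), 0 < ε → ∃ j, ∀ i ≤ k, ∀ t : ℝ, ‖iteratedDeriv i (f - g j) t‖ ≤ ε :=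
  stub_denseFamily_of_isCompact isCompact_Icc

end Summit.RiemannHypothesis.RiemannHypothesis.Theorems.SpectralTraceWindowTraceArch

end
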